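import Summits.BirchSwinnertonDyer.BirchSwinnertonDyer.Theorems.TwoAdicConverseTwoDivisionCubicDyadicType
import Summits.BirchSwinnertonDyer.BirchSwinnertonDyer.Theorems.TwoAdicConverseTwoTorsionNFPointCountModFour
import Literature.NumberTheory.EllipticCurves.QuadraticTwist
import HarnessLib

/-!
# Route `TwoAdicConverse` (rung S3), crux `OrdLambdaHalfAtTwo` (item 19556): the dyadic type is an invariant of the whole
# quadratic-twist family

Cell `bsd-2adic`, seat `bsd-2adic-conv-1` (GEN 21). THEOREMS ONLY — no named fact, no definition, nothing conditional. The `2`-adic square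
class of the discriminant does not change under ANY quadratic twist and ANY change of variables (`Δ(C • W^{(d)}) = u⁻¹²d⁶·Δ(W)`,
tree `quadraticTwist_Δ`, Mathlib `variableChange_Δ`); with `TwoAdicConverseTwoDivisionCubicDyadicType` the dyadic type of the
`2`-division field (`3` roots of `ψ₂²` in `ℚ₂` vs exactly `1`) is therefore CONSTANT on every quadratic-twist family inside
`GoodOrd ∨ Mult` at `2` — the pen's dyadic keying bit `w₂` (RC-246 (B)) is a twist-CLASS invariant, like the `λ`-half twist doors.

* `isSquare_padic_Δ_smul_quadraticTwist_iff` — `IsSquare (Δ(A) : ℚ_[2]) ↔ IsSquare (Δ(W) : ℚ_[2])` for `A = C • W^{(d)}`, `d ≠ 0`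
  (stated for `ℚ_[p]`, any `p`);
* `card_roots_twoTorsionPolynomial_padic_two_eq_of_smul_quadraticTwist` — for `W`, `A` globally minimal, both good ordinary or
  multiplicative at `2`, the numbers of `ℚ₂`-roots of their `2`-division cubics agree.

HONEST FRAMING: bookkeeping; nothing about `λ` or BSD; items 19556 / 19218 stay OPEN; BSD is not proved by any of this. PARTITION (D-0054):
none — RANK axis (S3). References: J. H. Silverman, *AEC* (2009), III.1, X.5.4 [SilvermanAEC2009].
-/

set_option linter.dupNamespace false
set_option autoImplicit false

noncomputable section

open scoped Classical
open WeierstrassCurve Literature.NumberTheory.EllipticCurves Literature.NumberTheory.EllipticCurves.Rank1Residual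
  Literature.NumberTheory.EllipticCurves.Greenberg1999

namespace Summit.BirchSwinnertonDyer.BirchSwinnertonDyer.Theorems.TwoAdicTwistConverse

/-- **The `p`-adic square class of `Δ` is invariant under quadratic twists and changes of variables**: for
`A = C • W.quadraticTwist d` (`d ≠ 0`), `Δ(A) = (u⁻⁶d³)²·Δ(W)`, so `Δ(A)` is a square in `ℚ_p` iff `Δ(W)` is.
[cite: SilvermanAEC2009, III.1 Table 3.1 and X.5.4] -/
theorem isSquare_padic_Δ_smul_quadraticTwist_iff (p : ℕ) [Fact p.Prime] (W A : WeierstrassCurve ℚ) {d : ℚ} (hd : d ≠ 0)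
    {C : VariableChange ℚ} (hA : C • W.quadraticTwist d = A) :
    IsSquare ((A.Δ : ℚ) : ℚ_[p]) ↔ IsSquare ((W.Δ : ℚ) : ℚ_[p]) := by
  have hΔ : A.Δ = (((C.u⁻¹ : ℚˣ) : ℚ) ^ 6 * d ^ 3) ^ 2 * W.Δ := by
    rw [← hA, variableChange_Δ, quadraticTwist_Δ]; ring
  have hc : ((((C.u⁻¹ : ℚˣ) : ℚ) ^ 6 * d ^ 3 : ℚ) : ℚ_[p]) ≠ 0 := by
    exact_mod_cast mul_ne_zero (pow_ne_zero _ (Units.ne_zero _)) (pow_ne_zero _ hd)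
  rw [hΔ, Rat.cast_mul, Rat.cast_pow]
  exact isSquare_sq_mul_iff hc _

/-- **The dyadic type is constant on a quadratic-twist family** inside `GoodOrd ∨ Mult` at `2`: for globally minimal `W`, `A` with
`C • W.quadraticTwist d = A` (`d ≠ 0`), both good ordinary or multiplicative at `2`, the `2`-division cubics of `W` and `A` have the
same number of roots in `ℚ₂` (`3` iff `Δ ∈ ℚ₂×²`, else `1`). [cite: SilvermanAEC2009, X.5.4] -/
theorem card_roots_twoTorsionPolynomial_padic_two_eq_of_smul_quadraticTwist (W A : WeierstrassCurve ℚ) [W.IsElliptic]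
    [W.IsGloballyMinimal] [A.IsElliptic] [A.IsGloballyMinimal] {d : ℚ} (hd : d ≠ 0) {C : VariableChange ℚ}
    (hA : C • W.quadraticTwist d = A) (hW : GoodOrd W 2 ∨ Mult W 2) (hA2 : GoodOrd A 2 ∨ Mult A 2) :
    Multiset.card ((A.twoTorsionPolynomial.toPoly).map (algebraMap ℚ ℚ_[2])).roots =
      Multiset.card ((W.twoTorsionPolynomial.toPoly).map (algebraMap ℚ ℚ_[2])).roots := by
  haveI : Fact (Nat.Prime 2) := ⟨Nat.prime_two⟩
  have hsq := isSquare_padic_Δ_smul_quadraticTwist_iff 2 W A hd hA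
  rcases card_roots_twoTorsionPolynomial_padic_two_eq_one_or_three A (odd_a₁_integralModelInt_of_goodOrd_or_mult A hA2)
    with hA1 | hA3
  · rw [hA1]
    by_contra hne
    rcases card_roots_twoTorsionPolynomial_padic_two_eq_one_or_three W (odd_a₁_integralModelInt_of_goodOrd_or_mult W hW)
      with hW1 | hW3
    · exact hne hW1.symm
    · have hΔW := (card_roots_twoTorsionPolynomial_padic_two_eq_three_iff_of_goodOrd_or_mult W hW).mp hW3
      have hΔA := (card_roots_twoTorsionPolynomial_padic_two_eq_three_iff_of_goodOrd_or_mult A hA2).mpr (hsq.mpr hΔW)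
      omega
  · rw [hA3]
    have hΔA := (card_roots_twoTorsionPolynomial_padic_two_eq_three_iff_of_goodOrd_or_mult A hA2).mp hA3
    exact ((card_roots_twoTorsionPolynomial_padic_two_eq_three_iff_of_goodOrd_or_mult W hW).mpr (hsq.mp hΔA)).symm

end Summit.BirchSwinnertonDyer.BirchSwinnertonDyer.Theorems.TwoAdicTwistConverse

end
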